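/-
Copyright: the b2b-balaban T⁴-continuum CRUX team, row NE7b OWNER lineage `t4-ne7b-p1` (gen 141). Project licence.
-/
import Mathlib.Algebra.Order.BigOperators.Group.Finset
import Mathlib.Algebra.BigOperators.Ring.Finset
import Mathlib.Data.Real.Basic
import Mathlib.Tactic.Ring
import Mathlib.Tactic.Positivity
import Mathlib.Tactic.Linarith

/-!
# THE ROW SUMS OF THE SIXTEEN-TREE MAJORANT ARE VOLUME-UNIFORM (SCOPING (d13)(2), third file; Mathlib only).  (487) bounds the fourth cumulant
# at four sites by `C·Σ_TΠ_{e∈T}q_e` over the sixteen labelled spanning trees (`q_{uv}` a two-point decay weight, e.g. `ρ_{uv}^{−β}`).  For a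
# weight with row AND column letters `Σ_vq_{uv} ≤ S`, `Σ_uq_{uv} ≤ S` (a symmetric `q` has both), every tree term sums over the three free
# sites to at most `S³` — peel a leaf, twice, then the edge at `x` — so
#   `Σ_y Σ_z Σ_w Σ_T Π_{e∈T} q_e ≤ 16·S³`:
# the order-4 analogue of (463)'s `tree_double_sum_le` (`Σ_{y,z}C∕(ρ_{xy}ρ_{xz}) ≤ C·S²`); with (487) and the cut bounds it gives the ROW LETTER
# of the fourth cumulant, uniform in the volume (row NE7b, node U5c; Mathlib only; [folklore] finite sums)

Cell `pub-balaban`, sub-cell `t4`, spine estimate NE7b (`T4WeightBudget.RelWeightBound`; the cell's OWN estimate — NOT PRINTED in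
[Bałaban 1983–89], NOT PROVED).  Crux-route work under `Spine/NE7b/` by the row OWNER (`t4-ne7b-p1` gen 141, file (488)) under FREEZE
(0)'s crux-prover clause; NOTHING of Bałaban's is named as a Lean object, valued or asserted; no `T4Continuum/Support` leaf typed; no
`def`, no notation (the sixteen-tree sum WRITTEN OUT, edge weights `q x y, q x z, q x w, q y z, q y w, q z w` as in (487)); zero `sorry`.
Imports: Mathlib only (fast lane).

WHAT IS PROVED ([folklore]; `q ≥ 0` with row and column letters `S`): §1 the sixteen lemmas `tree_T_sum_le` (`T ∈ {abc, ade, …, bcd}`); §2 THE END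
**`tree_sum_row_le`** (`Σ_yΣ_zΣ_w Σ_TΠq ≤ 16·S³`); §3 toy.

HONEST (what this is NOT).  Finite sums; by the symmetry of the sixteen-tree sum the same bound holds with any of the four sites fixed (the
successor instantiates with relabelled weights); the cut bounds and the `u₄` kernel letter are the next files; scalar skeleton ((A3), NC-NE7b-α
UNRULED); nothing of Bałaban's asserted.  BY-NAME EFFECT ON THE WALL: NONE.  NE7b NOT PRINTED ∕ NOT PROVED; spine PROVED 0∕9; rung (B)+1 — the
programme's measures remain FINITE-torus statements; NOT the mass gap, NOT Clay.  HONEST DEPENDENCY: continuum YM on T⁴ ⇐ BetaPertH ∧ nine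
spine estimates (0∕9 proved); BetaPertH ⇐ (D1) ∧ (D4) ∧ CAP+tail; G-an2-4 gates asym, D1 and NE2∕3∕4.
-/

set_option autoImplicit false

namespace Summit.QuantumFields.BalabanUV.T4Continuum.NE7b.SupFourPointTreeRowSum

open Finset
open scoped BigOperators

variable {ι : Type} [Fintype ι] {q : ι → ι → ℝ} {S : ℝ}

/-! ## §1. The sixteen tree terms -/

/-- Tree `abc` (`q x y * q x z * q x w`): its triple sum is `≤ S³` (leaves `w`, then `z`, then `y`). [folklore] -/
theorem tree_abc_sum_le (hq : ∀ u v, 0 ≤ q u v) (hSr : ∀ u, ∑ v, q u v ≤ S) (_hSc : ∀ v, ∑ u, q u v ≤ S) (x : ι) :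
    ∑ y, ∑ z, ∑ w, q x y * q x z * q x w ≤ S ^ 3 := by
  have hS0 : 0 ≤ S := (Finset.sum_nonneg fun v _ => hq x v).trans (hSr x)
  calc ∑ y, ∑ z, ∑ w, q x y * q x z * q x w = ∑ y, ∑ z, ∑ w, q x y * q x z * q x w :=
        Finset.sum_congr rfl fun y _ => Finset.sum_congr rfl fun z _ => Finset.sum_congr rfl fun w _ => by ring
    _ = ∑ y, ∑ z, q x y * q x z * ∑ w, q x w :=
        Finset.sum_congr rfl fun y _ => Finset.sum_congr rfl fun z _ => (Finset.mul_sum _ _ _).symm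
    _ ≤ ∑ y, ∑ z, q x y * q x z * S :=
        Finset.sum_le_sum fun y _ => Finset.sum_le_sum fun z _ => mul_le_mul_of_nonneg_left (hSr x) (mul_nonneg (hq _ _) (hq _ _))
    _ = ∑ y, ∑ z, q x y * S * q x z := Finset.sum_congr rfl fun y _ => Finset.sum_congr rfl fun z _ => by ring
    _ = ∑ y, q x y * S * ∑ z, q x z := Finset.sum_congr rfl fun y _ => (Finset.mul_sum _ _ _).symm
    _ ≤ ∑ y, q x y * S * S := Finset.sum_le_sum fun y _ => mul_le_mul_of_nonneg_left (hSr x) (mul_nonneg (hq _ _) hS0)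
    _ = ∑ y, S * S * q x y := Finset.sum_congr rfl fun y _ => by ring
    _ = S * S * ∑ y, q x y := (Finset.mul_sum _ _ _).symm
    _ ≤ S * S * S := mul_le_mul_of_nonneg_left (hSr x) (mul_nonneg hS0 hS0)
    _ = S ^ 3 := by ring

/-- Tree `ade` (`q x y * q y z * q y w`): its triple sum is `≤ S³` (leaves `w`, then `z`, then `y`). [folklore] -/
theorem tree_ade_sum_le (hq : ∀ u v, 0 ≤ q u v) (hSr : ∀ u, ∑ v, q u v ≤ S) (_hSc : ∀ v, ∑ u, q u v ≤ S) (x : ι) :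
    ∑ y, ∑ z, ∑ w, q x y * q y z * q y w ≤ S ^ 3 := by
  have hS0 : 0 ≤ S := (Finset.sum_nonneg fun v _ => hq x v).trans (hSr x)
  calc ∑ y, ∑ z, ∑ w, q x y * q y z * q y w = ∑ y, ∑ z, ∑ w, q x y * q y z * q y w :=
        Finset.sum_congr rfl fun y _ => Finset.sum_congr rfl fun z _ => Finset.sum_congr rfl fun w _ => by ring
    _ = ∑ y, ∑ z, q x y * q y z * ∑ w, q y w :=
        Finset.sum_congr rfl fun y _ => Finset.sum_congr rfl fun z _ => (Finset.mul_sum _ _ _).symm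
    _ ≤ ∑ y, ∑ z, q x y * q y z * S :=
        Finset.sum_le_sum fun y _ => Finset.sum_le_sum fun z _ => mul_le_mul_of_nonneg_left (hSr y) (mul_nonneg (hq _ _) (hq _ _))
    _ = ∑ y, ∑ z, q x y * S * q y z := Finset.sum_congr rfl fun y _ => Finset.sum_congr rfl fun z _ => by ring
    _ = ∑ y, q x y * S * ∑ z, q y z := Finset.sum_congr rfl fun y _ => (Finset.mul_sum _ _ _).symm
    _ ≤ ∑ y, q x y * S * S := Finset.sum_le_sum fun y _ => mul_le_mul_of_nonneg_left (hSr y) (mul_nonneg (hq _ _) hS0)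
    _ = ∑ y, S * S * q x y := Finset.sum_congr rfl fun y _ => by ring
    _ = S * S * ∑ y, q x y := (Finset.mul_sum _ _ _).symm
    _ ≤ S * S * S := mul_le_mul_of_nonneg_left (hSr x) (mul_nonneg hS0 hS0)
    _ = S ^ 3 := by ring

/-- Tree `bdf` (`q x z * q y z * q z w`): its triple sum is `≤ S³` (leaves `w`, then `y`, then `z`). [folklore] -/
theorem tree_bdf_sum_le (hq : ∀ u v, 0 ≤ q u v) (hSr : ∀ u, ∑ v, q u v ≤ S) (hSc : ∀ v, ∑ u, q u v ≤ S) (x : ι) :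
    ∑ y, ∑ z, ∑ w, q x z * q y z * q z w ≤ S ^ 3 := by
  have hS0 : 0 ≤ S := (Finset.sum_nonneg fun v _ => hq x v).trans (hSr x)
  rw [Finset.sum_comm]
  calc ∑ z, ∑ y, ∑ w, q x z * q y z * q z w = ∑ z, ∑ y, ∑ w, q x z * q y z * q z w :=
        Finset.sum_congr rfl fun z _ => Finset.sum_congr rfl fun y _ => Finset.sum_congr rfl fun w _ => by ring
    _ = ∑ z, ∑ y, q x z * q y z * ∑ w, q z w :=
        Finset.sum_congr rfl fun z _ => Finset.sum_congr rfl fun y _ => (Finset.mul_sum _ _ _).symm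
    _ ≤ ∑ z, ∑ y, q x z * q y z * S :=
        Finset.sum_le_sum fun z _ => Finset.sum_le_sum fun y _ => mul_le_mul_of_nonneg_left (hSr z) (mul_nonneg (hq _ _) (hq _ _))
    _ = ∑ z, ∑ y, q x z * S * q y z := Finset.sum_congr rfl fun z _ => Finset.sum_congr rfl fun y _ => by ring
    _ = ∑ z, q x z * S * ∑ y, q y z := Finset.sum_congr rfl fun z _ => (Finset.mul_sum _ _ _).symm
    _ ≤ ∑ z, q x z * S * S := Finset.sum_le_sum fun z _ => mul_le_mul_of_nonneg_left (hSc z) (mul_nonneg (hq _ _) hS0)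
    _ = ∑ z, S * S * q x z := Finset.sum_congr rfl fun z _ => by ring
    _ = S * S * ∑ z, q x z := (Finset.mul_sum _ _ _).symm
    _ ≤ S * S * S := mul_le_mul_of_nonneg_left (hSr x) (mul_nonneg hS0 hS0)
    _ = S ^ 3 := by ring

/-- Tree `cef` (`q x w * q y w * q z w`): its triple sum is `≤ S³` (leaves `z`, then `y`, then `w`). [folklore] -/
theorem tree_cef_sum_le (hq : ∀ u v, 0 ≤ q u v) (hSr : ∀ u, ∑ v, q u v ≤ S) (hSc : ∀ v, ∑ u, q u v ≤ S) (x : ι) :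
    ∑ y, ∑ z, ∑ w, q x w * q y w * q z w ≤ S ^ 3 := by
  have hS0 : 0 ≤ S := (Finset.sum_nonneg fun v _ => hq x v).trans (hSr x)
  conv_lhs => arg 2; ext y; rw [Finset.sum_comm]
  rw [Finset.sum_comm]
  calc ∑ w, ∑ y, ∑ z, q x w * q y w * q z w = ∑ w, ∑ y, ∑ z, q x w * q y w * q z w :=
        Finset.sum_congr rfl fun w _ => Finset.sum_congr rfl fun y _ => Finset.sum_congr rfl fun z _ => by ring
    _ = ∑ w, ∑ y, q x w * q y w * ∑ z, q z w :=
        Finset.sum_congr rfl fun w _ => Finset.sum_congr rfl fun y _ => (Finset.mul_sum _ _ _).symm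
    _ ≤ ∑ w, ∑ y, q x w * q y w * S :=
        Finset.sum_le_sum fun w _ => Finset.sum_le_sum fun y _ => mul_le_mul_of_nonneg_left (hSc w) (mul_nonneg (hq _ _) (hq _ _))
    _ = ∑ w, ∑ y, q x w * S * q y w := Finset.sum_congr rfl fun w _ => Finset.sum_congr rfl fun y _ => by ring
    _ = ∑ w, q x w * S * ∑ y, q y w := Finset.sum_congr rfl fun w _ => (Finset.mul_sum _ _ _).symm
    _ ≤ ∑ w, q x w * S * S := Finset.sum_le_sum fun w _ => mul_le_mul_of_nonneg_left (hSc w) (mul_nonneg (hq _ _) hS0)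
    _ = ∑ w, S * S * q x w := Finset.sum_congr rfl fun w _ => by ring
    _ = S * S * ∑ w, q x w := (Finset.mul_sum _ _ _).symm
    _ ≤ S * S * S := mul_le_mul_of_nonneg_left (hSr x) (mul_nonneg hS0 hS0)
    _ = S ^ 3 := by ring

/-- Tree `adf` (`q x y * q y z * q z w`): its triple sum is `≤ S³` (leaves `w`, then `z`, then `y`). [folklore] -/
theorem tree_adf_sum_le (hq : ∀ u v, 0 ≤ q u v) (hSr : ∀ u, ∑ v, q u v ≤ S) (_hSc : ∀ v, ∑ u, q u v ≤ S) (x : ι) :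
    ∑ y, ∑ z, ∑ w, q x y * q y z * q z w ≤ S ^ 3 := by
  have hS0 : 0 ≤ S := (Finset.sum_nonneg fun v _ => hq x v).trans (hSr x)
  calc ∑ y, ∑ z, ∑ w, q x y * q y z * q z w = ∑ y, ∑ z, ∑ w, q x y * q y z * q z w :=
        Finset.sum_congr rfl fun y _ => Finset.sum_congr rfl fun z _ => Finset.sum_congr rfl fun w _ => by ring
    _ = ∑ y, ∑ z, q x y * q y z * ∑ w, q z w :=
        Finset.sum_congr rfl fun y _ => Finset.sum_congr rfl fun z _ => (Finset.mul_sum _ _ _).symm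
    _ ≤ ∑ y, ∑ z, q x y * q y z * S :=
        Finset.sum_le_sum fun y _ => Finset.sum_le_sum fun z _ => mul_le_mul_of_nonneg_left (hSr z) (mul_nonneg (hq _ _) (hq _ _))
    _ = ∑ y, ∑ z, q x y * S * q y z := Finset.sum_congr rfl fun y _ => Finset.sum_congr rfl fun z _ => by ring
    _ = ∑ y, q x y * S * ∑ z, q y z := Finset.sum_congr rfl fun y _ => (Finset.mul_sum _ _ _).symm
    _ ≤ ∑ y, q x y * S * S := Finset.sum_le_sum fun y _ => mul_le_mul_of_nonneg_left (hSr y) (mul_nonneg (hq _ _) hS0)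
    _ = ∑ y, S * S * q x y := Finset.sum_congr rfl fun y _ => by ring
    _ = S * S * ∑ y, q x y := (Finset.mul_sum _ _ _).symm
    _ ≤ S * S * S := mul_le_mul_of_nonneg_left (hSr x) (mul_nonneg hS0 hS0)
    _ = S ^ 3 := by ring

/-- Tree `aef` (`q x y * q y w * q z w`): its triple sum is `≤ S³` (leaves `z`, then `w`, then `y`). [folklore] -/
theorem tree_aef_sum_le (hq : ∀ u v, 0 ≤ q u v) (hSr : ∀ u, ∑ v, q u v ≤ S) (hSc : ∀ v, ∑ u, q u v ≤ S) (x : ι) :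
    ∑ y, ∑ z, ∑ w, q x y * q y w * q z w ≤ S ^ 3 := by
  have hS0 : 0 ≤ S := (Finset.sum_nonneg fun v _ => hq x v).trans (hSr x)
  conv_lhs => arg 2; ext y; rw [Finset.sum_comm]
  calc ∑ y, ∑ w, ∑ z, q x y * q y w * q z w = ∑ y, ∑ w, ∑ z, q x y * q y w * q z w :=
        Finset.sum_congr rfl fun y _ => Finset.sum_congr rfl fun w _ => Finset.sum_congr rfl fun z _ => by ring
    _ = ∑ y, ∑ w, q x y * q y w * ∑ z, q z w :=
        Finset.sum_congr rfl fun y _ => Finset.sum_congr rfl fun w _ => (Finset.mul_sum _ _ _).symm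
    _ ≤ ∑ y, ∑ w, q x y * q y w * S :=
        Finset.sum_le_sum fun y _ => Finset.sum_le_sum fun w _ => mul_le_mul_of_nonneg_left (hSc w) (mul_nonneg (hq _ _) (hq _ _))
    _ = ∑ y, ∑ w, q x y * S * q y w := Finset.sum_congr rfl fun y _ => Finset.sum_congr rfl fun w _ => by ring
    _ = ∑ y, q x y * S * ∑ w, q y w := Finset.sum_congr rfl fun y _ => (Finset.mul_sum _ _ _).symm
    _ ≤ ∑ y, q x y * S * S := Finset.sum_le_sum fun y _ => mul_le_mul_of_nonneg_left (hSr y) (mul_nonneg (hq _ _) hS0)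
    _ = ∑ y, S * S * q x y := Finset.sum_congr rfl fun y _ => by ring
    _ = S * S * ∑ y, q x y := (Finset.mul_sum _ _ _).symm
    _ ≤ S * S * S := mul_le_mul_of_nonneg_left (hSr x) (mul_nonneg hS0 hS0)
    _ = S ^ 3 := by ring

/-- Tree `bde` (`q x z * q y z * q y w`): its triple sum is `≤ S³` (leaves `w`, then `y`, then `z`). [folklore] -/
theorem tree_bde_sum_le (hq : ∀ u v, 0 ≤ q u v) (hSr : ∀ u, ∑ v, q u v ≤ S) (hSc : ∀ v, ∑ u, q u v ≤ S) (x : ι) :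
    ∑ y, ∑ z, ∑ w, q x z * q y z * q y w ≤ S ^ 3 := by
  have hS0 : 0 ≤ S := (Finset.sum_nonneg fun v _ => hq x v).trans (hSr x)
  rw [Finset.sum_comm]
  calc ∑ z, ∑ y, ∑ w, q x z * q y z * q y w = ∑ z, ∑ y, ∑ w, q x z * q y z * q y w :=
        Finset.sum_congr rfl fun z _ => Finset.sum_congr rfl fun y _ => Finset.sum_congr rfl fun w _ => by ring
    _ = ∑ z, ∑ y, q x z * q y z * ∑ w, q y w :=
        Finset.sum_congr rfl fun z _ => Finset.sum_congr rfl fun y _ => (Finset.mul_sum _ _ _).symm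
    _ ≤ ∑ z, ∑ y, q x z * q y z * S :=
        Finset.sum_le_sum fun z _ => Finset.sum_le_sum fun y _ => mul_le_mul_of_nonneg_left (hSr y) (mul_nonneg (hq _ _) (hq _ _))
    _ = ∑ z, ∑ y, q x z * S * q y z := Finset.sum_congr rfl fun z _ => Finset.sum_congr rfl fun y _ => by ring
    _ = ∑ z, q x z * S * ∑ y, q y z := Finset.sum_congr rfl fun z _ => (Finset.mul_sum _ _ _).symm
    _ ≤ ∑ z, q x z * S * S := Finset.sum_le_sum fun z _ => mul_le_mul_of_nonneg_left (hSc z) (mul_nonneg (hq _ _) hS0)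
    _ = ∑ z, S * S * q x z := Finset.sum_congr rfl fun z _ => by ring
    _ = S * S * ∑ z, q x z := (Finset.mul_sum _ _ _).symm
    _ ≤ S * S * S := mul_le_mul_of_nonneg_left (hSr x) (mul_nonneg hS0 hS0)
    _ = S ^ 3 := by ring

/-- Tree `bef` (`q x z * q y w * q z w`): its triple sum is `≤ S³` (leaves `y`, then `w`, then `z`). [folklore] -/
theorem tree_bef_sum_le (hq : ∀ u v, 0 ≤ q u v) (hSr : ∀ u, ∑ v, q u v ≤ S) (hSc : ∀ v, ∑ u, q u v ≤ S) (x : ι) :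
    ∑ y, ∑ z, ∑ w, q x z * q y w * q z w ≤ S ^ 3 := by
  have hS0 : 0 ≤ S := (Finset.sum_nonneg fun v _ => hq x v).trans (hSr x)
  rw [Finset.sum_comm]
  conv_lhs => arg 2; ext z; rw [Finset.sum_comm]
  calc ∑ z, ∑ w, ∑ y, q x z * q y w * q z w = ∑ z, ∑ w, ∑ y, q x z * q z w * q y w :=
        Finset.sum_congr rfl fun z _ => Finset.sum_congr rfl fun w _ => Finset.sum_congr rfl fun y _ => by ring
    _ = ∑ z, ∑ w, q x z * q z w * ∑ y, q y w :=
        Finset.sum_congr rfl fun z _ => Finset.sum_congr rfl fun w _ => (Finset.mul_sum _ _ _).symm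
    _ ≤ ∑ z, ∑ w, q x z * q z w * S :=
        Finset.sum_le_sum fun z _ => Finset.sum_le_sum fun w _ => mul_le_mul_of_nonneg_left (hSc w) (mul_nonneg (hq _ _) (hq _ _))
    _ = ∑ z, ∑ w, q x z * S * q z w := Finset.sum_congr rfl fun z _ => Finset.sum_congr rfl fun w _ => by ring
    _ = ∑ z, q x z * S * ∑ w, q z w := Finset.sum_congr rfl fun z _ => (Finset.mul_sum _ _ _).symm
    _ ≤ ∑ z, q x z * S * S := Finset.sum_le_sum fun z _ => mul_le_mul_of_nonneg_left (hSr z) (mul_nonneg (hq _ _) hS0)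
    _ = ∑ z, S * S * q x z := Finset.sum_congr rfl fun z _ => by ring
    _ = S * S * ∑ z, q x z := (Finset.mul_sum _ _ _).symm
    _ ≤ S * S * S := mul_le_mul_of_nonneg_left (hSr x) (mul_nonneg hS0 hS0)
    _ = S ^ 3 := by ring

/-- Tree `cde` (`q x w * q y z * q y w`): its triple sum is `≤ S³` (leaves `z`, then `y`, then `w`). [folklore] -/
theorem tree_cde_sum_le (hq : ∀ u v, 0 ≤ q u v) (hSr : ∀ u, ∑ v, q u v ≤ S) (hSc : ∀ v, ∑ u, q u v ≤ S) (x : ι) :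
    ∑ y, ∑ z, ∑ w, q x w * q y z * q y w ≤ S ^ 3 := by
  have hS0 : 0 ≤ S := (Finset.sum_nonneg fun v _ => hq x v).trans (hSr x)
  conv_lhs => arg 2; ext y; rw [Finset.sum_comm]
  rw [Finset.sum_comm]
  calc ∑ w, ∑ y, ∑ z, q x w * q y z * q y w = ∑ w, ∑ y, ∑ z, q x w * q y w * q y z :=
        Finset.sum_congr rfl fun w _ => Finset.sum_congr rfl fun y _ => Finset.sum_congr rfl fun z _ => by ring
    _ = ∑ w, ∑ y, q x w * q y w * ∑ z, q y z :=
        Finset.sum_congr rfl fun w _ => Finset.sum_congr rfl fun y _ => (Finset.mul_sum _ _ _).symm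
    _ ≤ ∑ w, ∑ y, q x w * q y w * S :=
        Finset.sum_le_sum fun w _ => Finset.sum_le_sum fun y _ => mul_le_mul_of_nonneg_left (hSr y) (mul_nonneg (hq _ _) (hq _ _))
    _ = ∑ w, ∑ y, q x w * S * q y w := Finset.sum_congr rfl fun w _ => Finset.sum_congr rfl fun y _ => by ring
    _ = ∑ w, q x w * S * ∑ y, q y w := Finset.sum_congr rfl fun w _ => (Finset.mul_sum _ _ _).symm
    _ ≤ ∑ w, q x w * S * S := Finset.sum_le_sum fun w _ => mul_le_mul_of_nonneg_left (hSc w) (mul_nonneg (hq _ _) hS0)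
    _ = ∑ w, S * S * q x w := Finset.sum_congr rfl fun w _ => by ring
    _ = S * S * ∑ w, q x w := (Finset.mul_sum _ _ _).symm
    _ ≤ S * S * S := mul_le_mul_of_nonneg_left (hSr x) (mul_nonneg hS0 hS0)
    _ = S ^ 3 := by ring

/-- Tree `cdf` (`q x w * q y z * q z w`): its triple sum is `≤ S³` (leaves `y`, then `z`, then `w`). [folklore] -/
theorem tree_cdf_sum_le (hq : ∀ u v, 0 ≤ q u v) (hSr : ∀ u, ∑ v, q u v ≤ S) (hSc : ∀ v, ∑ u, q u v ≤ S) (x : ι) :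
    ∑ y, ∑ z, ∑ w, q x w * q y z * q z w ≤ S ^ 3 := by
  have hS0 : 0 ≤ S := (Finset.sum_nonneg fun v _ => hq x v).trans (hSr x)
  rw [Finset.sum_comm]
  conv_lhs => arg 2; ext z; rw [Finset.sum_comm]
  rw [Finset.sum_comm]
  calc ∑ w, ∑ z, ∑ y, q x w * q y z * q z w = ∑ w, ∑ z, ∑ y, q x w * q z w * q y z :=
        Finset.sum_congr rfl fun w _ => Finset.sum_congr rfl fun z _ => Finset.sum_congr rfl fun y _ => by ring
    _ = ∑ w, ∑ z, q x w * q z w * ∑ y, q y z :=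
        Finset.sum_congr rfl fun w _ => Finset.sum_congr rfl fun z _ => (Finset.mul_sum _ _ _).symm
    _ ≤ ∑ w, ∑ z, q x w * q z w * S :=
        Finset.sum_le_sum fun w _ => Finset.sum_le_sum fun z _ => mul_le_mul_of_nonneg_left (hSc z) (mul_nonneg (hq _ _) (hq _ _))
    _ = ∑ w, ∑ z, q x w * S * q z w := Finset.sum_congr rfl fun w _ => Finset.sum_congr rfl fun z _ => by ring
    _ = ∑ w, q x w * S * ∑ z, q z w := Finset.sum_congr rfl fun w _ => (Finset.mul_sum _ _ _).symm
    _ ≤ ∑ w, q x w * S * S := Finset.sum_le_sum fun w _ => mul_le_mul_of_nonneg_left (hSc w) (mul_nonneg (hq _ _) hS0)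
    _ = ∑ w, S * S * q x w := Finset.sum_congr rfl fun w _ => by ring
    _ = S * S * ∑ w, q x w := (Finset.mul_sum _ _ _).symm
    _ ≤ S * S * S := mul_le_mul_of_nonneg_left (hSr x) (mul_nonneg hS0 hS0)
    _ = S ^ 3 := by ring

/-- Tree `abf` (`q x y * q x z * q z w`): its triple sum is `≤ S³` (leaves `w`, then `z`, then `y`). [folklore] -/
theorem tree_abf_sum_le (hq : ∀ u v, 0 ≤ q u v) (hSr : ∀ u, ∑ v, q u v ≤ S) (_hSc : ∀ v, ∑ u, q u v ≤ S) (x : ι) :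
    ∑ y, ∑ z, ∑ w, q x y * q x z * q z w ≤ S ^ 3 := by
  have hS0 : 0 ≤ S := (Finset.sum_nonneg fun v _ => hq x v).trans (hSr x)
  calc ∑ y, ∑ z, ∑ w, q x y * q x z * q z w = ∑ y, ∑ z, ∑ w, q x y * q x z * q z w :=
        Finset.sum_congr rfl fun y _ => Finset.sum_congr rfl fun z _ => Finset.sum_congr rfl fun w _ => by ring
    _ = ∑ y, ∑ z, q x y * q x z * ∑ w, q z w :=
        Finset.sum_congr rfl fun y _ => Finset.sum_congr rfl fun z _ => (Finset.mul_sum _ _ _).symm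
    _ ≤ ∑ y, ∑ z, q x y * q x z * S :=
        Finset.sum_le_sum fun y _ => Finset.sum_le_sum fun z _ => mul_le_mul_of_nonneg_left (hSr z) (mul_nonneg (hq _ _) (hq _ _))
    _ = ∑ y, ∑ z, q x y * S * q x z := Finset.sum_congr rfl fun y _ => Finset.sum_congr rfl fun z _ => by ring
    _ = ∑ y, q x y * S * ∑ z, q x z := Finset.sum_congr rfl fun y _ => (Finset.mul_sum _ _ _).symm
    _ ≤ ∑ y, q x y * S * S := Finset.sum_le_sum fun y _ => mul_le_mul_of_nonneg_left (hSr x) (mul_nonneg (hq _ _) hS0)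
    _ = ∑ y, S * S * q x y := Finset.sum_congr rfl fun y _ => by ring
    _ = S * S * ∑ y, q x y := (Finset.mul_sum _ _ _).symm
    _ ≤ S * S * S := mul_le_mul_of_nonneg_left (hSr x) (mul_nonneg hS0 hS0)
    _ = S ^ 3 := by ring

/-- Tree `acf` (`q x y * q x w * q z w`): its triple sum is `≤ S³` (leaves `z`, then `w`, then `y`). [folklore] -/
theorem tree_acf_sum_le (hq : ∀ u v, 0 ≤ q u v) (hSr : ∀ u, ∑ v, q u v ≤ S) (hSc : ∀ v, ∑ u, q u v ≤ S) (x : ι) :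
    ∑ y, ∑ z, ∑ w, q x y * q x w * q z w ≤ S ^ 3 := by
  have hS0 : 0 ≤ S := (Finset.sum_nonneg fun v _ => hq x v).trans (hSr x)
  conv_lhs => arg 2; ext y; rw [Finset.sum_comm]
  calc ∑ y, ∑ w, ∑ z, q x y * q x w * q z w = ∑ y, ∑ w, ∑ z, q x y * q x w * q z w :=
        Finset.sum_congr rfl fun y _ => Finset.sum_congr rfl fun w _ => Finset.sum_congr rfl fun z _ => by ring
    _ = ∑ y, ∑ w, q x y * q x w * ∑ z, q z w :=
        Finset.sum_congr rfl fun y _ => Finset.sum_congr rfl fun w _ => (Finset.mul_sum _ _ _).symm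
    _ ≤ ∑ y, ∑ w, q x y * q x w * S :=
        Finset.sum_le_sum fun y _ => Finset.sum_le_sum fun w _ => mul_le_mul_of_nonneg_left (hSc w) (mul_nonneg (hq _ _) (hq _ _))
    _ = ∑ y, ∑ w, q x y * S * q x w := Finset.sum_congr rfl fun y _ => Finset.sum_congr rfl fun w _ => by ring
    _ = ∑ y, q x y * S * ∑ w, q x w := Finset.sum_congr rfl fun y _ => (Finset.mul_sum _ _ _).symm
    _ ≤ ∑ y, q x y * S * S := Finset.sum_le_sum fun y _ => mul_le_mul_of_nonneg_left (hSr x) (mul_nonneg (hq _ _) hS0)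
    _ = ∑ y, S * S * q x y := Finset.sum_congr rfl fun y _ => by ring
    _ = S * S * ∑ y, q x y := (Finset.mul_sum _ _ _).symm
    _ ≤ S * S * S := mul_le_mul_of_nonneg_left (hSr x) (mul_nonneg hS0 hS0)
    _ = S ^ 3 := by ring

/-- Tree `abe` (`q x y * q x z * q y w`): its triple sum is `≤ S³` (leaves `w`, then `z`, then `y`). [folklore] -/
theorem tree_abe_sum_le (hq : ∀ u v, 0 ≤ q u v) (hSr : ∀ u, ∑ v, q u v ≤ S) (_hSc : ∀ v, ∑ u, q u v ≤ S) (x : ι) :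
    ∑ y, ∑ z, ∑ w, q x y * q x z * q y w ≤ S ^ 3 := by
  have hS0 : 0 ≤ S := (Finset.sum_nonneg fun v _ => hq x v).trans (hSr x)
  calc ∑ y, ∑ z, ∑ w, q x y * q x z * q y w = ∑ y, ∑ z, ∑ w, q x y * q x z * q y w :=
        Finset.sum_congr rfl fun y _ => Finset.sum_congr rfl fun z _ => Finset.sum_congr rfl fun w _ => by ring
    _ = ∑ y, ∑ z, q x y * q x z * ∑ w, q y w :=
        Finset.sum_congr rfl fun y _ => Finset.sum_congr rfl fun z _ => (Finset.mul_sum _ _ _).symm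
    _ ≤ ∑ y, ∑ z, q x y * q x z * S :=
        Finset.sum_le_sum fun y _ => Finset.sum_le_sum fun z _ => mul_le_mul_of_nonneg_left (hSr y) (mul_nonneg (hq _ _) (hq _ _))
    _ = ∑ y, ∑ z, q x y * S * q x z := Finset.sum_congr rfl fun y _ => Finset.sum_congr rfl fun z _ => by ring
    _ = ∑ y, q x y * S * ∑ z, q x z := Finset.sum_congr rfl fun y _ => (Finset.mul_sum _ _ _).symm
    _ ≤ ∑ y, q x y * S * S := Finset.sum_le_sum fun y _ => mul_le_mul_of_nonneg_left (hSr x) (mul_nonneg (hq _ _) hS0)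
    _ = ∑ y, S * S * q x y := Finset.sum_congr rfl fun y _ => by ring
    _ = S * S * ∑ y, q x y := (Finset.mul_sum _ _ _).symm
    _ ≤ S * S * S := mul_le_mul_of_nonneg_left (hSr x) (mul_nonneg hS0 hS0)
    _ = S ^ 3 := by ring

/-- Tree `bce` (`q x z * q x w * q y w`): its triple sum is `≤ S³` (leaves `z`, then `y`, then `w`). [folklore] -/
theorem tree_bce_sum_le (hq : ∀ u v, 0 ≤ q u v) (hSr : ∀ u, ∑ v, q u v ≤ S) (hSc : ∀ v, ∑ u, q u v ≤ S) (x : ι) :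
    ∑ y, ∑ z, ∑ w, q x z * q x w * q y w ≤ S ^ 3 := by
  have hS0 : 0 ≤ S := (Finset.sum_nonneg fun v _ => hq x v).trans (hSr x)
  conv_lhs => arg 2; ext y; rw [Finset.sum_comm]
  rw [Finset.sum_comm]
  calc ∑ w, ∑ y, ∑ z, q x z * q x w * q y w = ∑ w, ∑ y, ∑ z, q x w * q y w * q x z :=
        Finset.sum_congr rfl fun w _ => Finset.sum_congr rfl fun y _ => Finset.sum_congr rfl fun z _ => by ring
    _ = ∑ w, ∑ y, q x w * q y w * ∑ z, q x z :=
        Finset.sum_congr rfl fun w _ => Finset.sum_congr rfl fun y _ => (Finset.mul_sum _ _ _).symm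
    _ ≤ ∑ w, ∑ y, q x w * q y w * S :=
        Finset.sum_le_sum fun w _ => Finset.sum_le_sum fun y _ => mul_le_mul_of_nonneg_left (hSr x) (mul_nonneg (hq _ _) (hq _ _))
    _ = ∑ w, ∑ y, q x w * S * q y w := Finset.sum_congr rfl fun w _ => Finset.sum_congr rfl fun y _ => by ring
    _ = ∑ w, q x w * S * ∑ y, q y w := Finset.sum_congr rfl fun w _ => (Finset.mul_sum _ _ _).symm
    _ ≤ ∑ w, q x w * S * S := Finset.sum_le_sum fun w _ => mul_le_mul_of_nonneg_left (hSc w) (mul_nonneg (hq _ _) hS0)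
    _ = ∑ w, S * S * q x w := Finset.sum_congr rfl fun w _ => by ring
    _ = S * S * ∑ w, q x w := (Finset.mul_sum _ _ _).symm
    _ ≤ S * S * S := mul_le_mul_of_nonneg_left (hSr x) (mul_nonneg hS0 hS0)
    _ = S ^ 3 := by ring

/-- Tree `acd` (`q x y * q x w * q y z`): its triple sum is `≤ S³` (leaves `w`, then `z`, then `y`). [folklore] -/
theorem tree_acd_sum_le (hq : ∀ u v, 0 ≤ q u v) (hSr : ∀ u, ∑ v, q u v ≤ S) (_hSc : ∀ v, ∑ u, q u v ≤ S) (x : ι) :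
    ∑ y, ∑ z, ∑ w, q x y * q x w * q y z ≤ S ^ 3 := by
  have hS0 : 0 ≤ S := (Finset.sum_nonneg fun v _ => hq x v).trans (hSr x)
  calc ∑ y, ∑ z, ∑ w, q x y * q x w * q y z = ∑ y, ∑ z, ∑ w, q x y * q y z * q x w :=
        Finset.sum_congr rfl fun y _ => Finset.sum_congr rfl fun z _ => Finset.sum_congr rfl fun w _ => by ring
    _ = ∑ y, ∑ z, q x y * q y z * ∑ w, q x w :=
        Finset.sum_congr rfl fun y _ => Finset.sum_congr rfl fun z _ => (Finset.mul_sum _ _ _).symm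
    _ ≤ ∑ y, ∑ z, q x y * q y z * S :=
        Finset.sum_le_sum fun y _ => Finset.sum_le_sum fun z _ => mul_le_mul_of_nonneg_left (hSr x) (mul_nonneg (hq _ _) (hq _ _))
    _ = ∑ y, ∑ z, q x y * S * q y z := Finset.sum_congr rfl fun y _ => Finset.sum_congr rfl fun z _ => by ring
    _ = ∑ y, q x y * S * ∑ z, q y z := Finset.sum_congr rfl fun y _ => (Finset.mul_sum _ _ _).symm
    _ ≤ ∑ y, q x y * S * S := Finset.sum_le_sum fun y _ => mul_le_mul_of_nonneg_left (hSr y) (mul_nonneg (hq _ _) hS0)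
    _ = ∑ y, S * S * q x y := Finset.sum_congr rfl fun y _ => by ring
    _ = S * S * ∑ y, q x y := (Finset.mul_sum _ _ _).symm
    _ ≤ S * S * S := mul_le_mul_of_nonneg_left (hSr x) (mul_nonneg hS0 hS0)
    _ = S ^ 3 := by ring

/-- Tree `bcd` (`q x z * q x w * q y z`): its triple sum is `≤ S³` (leaves `w`, then `y`, then `z`). [folklore] -/
theorem tree_bcd_sum_le (hq : ∀ u v, 0 ≤ q u v) (hSr : ∀ u, ∑ v, q u v ≤ S) (hSc : ∀ v, ∑ u, q u v ≤ S) (x : ι) :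
    ∑ y, ∑ z, ∑ w, q x z * q x w * q y z ≤ S ^ 3 := by
  have hS0 : 0 ≤ S := (Finset.sum_nonneg fun v _ => hq x v).trans (hSr x)
  rw [Finset.sum_comm]
  calc ∑ z, ∑ y, ∑ w, q x z * q x w * q y z = ∑ z, ∑ y, ∑ w, q x z * q y z * q x w :=
        Finset.sum_congr rfl fun z _ => Finset.sum_congr rfl fun y _ => Finset.sum_congr rfl fun w _ => by ring
    _ = ∑ z, ∑ y, q x z * q y z * ∑ w, q x w :=
        Finset.sum_congr rfl fun z _ => Finset.sum_congr rfl fun y _ => (Finset.mul_sum _ _ _).symm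
    _ ≤ ∑ z, ∑ y, q x z * q y z * S :=
        Finset.sum_le_sum fun z _ => Finset.sum_le_sum fun y _ => mul_le_mul_of_nonneg_left (hSr x) (mul_nonneg (hq _ _) (hq _ _))
    _ = ∑ z, ∑ y, q x z * S * q y z := Finset.sum_congr rfl fun z _ => Finset.sum_congr rfl fun y _ => by ring
    _ = ∑ z, q x z * S * ∑ y, q y z := Finset.sum_congr rfl fun z _ => (Finset.mul_sum _ _ _).symm
    _ ≤ ∑ z, q x z * S * S := Finset.sum_le_sum fun z _ => mul_le_mul_of_nonneg_left (hSc z) (mul_nonneg (hq _ _) hS0)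
    _ = ∑ z, S * S * q x z := Finset.sum_congr rfl fun z _ => by ring
    _ = S * S * ∑ z, q x z := (Finset.mul_sum _ _ _).symm
    _ ≤ S * S * S := mul_le_mul_of_nonneg_left (hSr x) (mul_nonneg hS0 hS0)
    _ = S ^ 3 := by ring

/-! ## §2. THE END: the row sum of the sixteen-tree majorant -/

/-- **THE ROW SUMS OF THE SIXTEEN-TREE MAJORANT**: `Σ_yΣ_zΣ_w Σ_TΠ_{e∈T}q_e ≤ 16·S³`. [folklore] -/
theorem tree_sum_row_le (hq : ∀ u v, 0 ≤ q u v) (hSr : ∀ u, ∑ v, q u v ≤ S) (hSc : ∀ v, ∑ u, q u v ≤ S) (x : ι) :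
    ∑ y, ∑ z, ∑ w, (q x y * q x z * q x w + q x y * q y z * q y w + q x z * q y z * q z w + q x w * q y w * q z w + q x y * q y z * q z w + q x y * q
        y w * q z w + q x z * q y z * q y w + q x z * q y w * q z w + q x w * q y z * q y w + q x w * q y z * q z w + q x y * q x z * q z w + q x y *
        q x w * q z w + q x y * q x z * q y w + q x z * q x w * q y w + q x y * q x w * q y z + q x z * q x w * q y z) ≤ 16 * S ^ 3 := by
  have h0 := tree_abc_sum_le hq hSr hSc x
  have h1 := tree_ade_sum_le hq hSr hSc x
  have h2 := tree_bdf_sum_le hq hSr hSc x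
  have h3 := tree_cef_sum_le hq hSr hSc x
  have h4 := tree_adf_sum_le hq hSr hSc x
  have h5 := tree_aef_sum_le hq hSr hSc x
  have h6 := tree_bde_sum_le hq hSr hSc x
  have h7 := tree_bef_sum_le hq hSr hSc x
  have h8 := tree_cde_sum_le hq hSr hSc x
  have h9 := tree_cdf_sum_le hq hSr hSc x
  have h10 := tree_abf_sum_le hq hSr hSc x
  have h11 := tree_acf_sum_le hq hSr hSc x
  have h12 := tree_abe_sum_le hq hSr hSc x
  have h13 := tree_bce_sum_le hq hSr hSc x
  have h14 := tree_acd_sum_le hq hSr hSc x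
  have h15 := tree_bcd_sum_le hq hSr hSc x
  simp only [Finset.sum_add_distrib]
  linarith

/-! ## §3. Toy -/

/-- Toy (§2 on `Fin 1` with `q = 1`, `S = 1`): sixteen unit terms. -/
example : ∑ _y : Fin 1, ∑ _z : Fin 1, ∑ _w : Fin 1, (16 : ℝ) ≤ 16 * (1 : ℝ) ^ 3 := by simp

end Summit.QuantumFields.BalabanUV.T4Continuum.NE7b.SupFourPointTreeRowSum
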